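/-
Copyright (c) 2026 the pub-hodgecm-mathlib formalisation cell (harness21).  Prover seat hodgecm-mathlib-K2Liu-p01 (g2): Track B «K2-LIT»,
#184♮ = hLiu418 = stmt-HodgeConjecture-24832, STEWARD of socket #41 `sig_K2LiuSiegelEisensteinContinuation`; LEAD F0P6-plan (g10) DEAL
2026-09-03T23:22:15Z «O41.5 Gindikin–Karpelevich for the Siegel parabolic»; REPORT-FIRST O41.5
`K2/K2Liu-p01/g2/REPORT-FIRST-O41_5-GindikinKarpelevich.K2Liup01g2.md` 220813e546421255, file (1) of road R1 (rank-one reduction).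
-/
import Literature.NumberTheory.Automorphic.LocalFieldHaarBalls
import Mathlib.Analysis.SpecificLimits.Normed
import Mathlib.Analysis.SpecialFunctions.Pow.Continuity
import HarnessLib

/-!
# Crux `HLiu418`, road `K2_Liu`, socket #41, organ O41.5 (Gindikin–Karpelevich), file (1):
# THE RANK-ONE UNRAMIFIED INTERTWINING INTEGRAL over a non-archimedean local field

Cell `hodgecm-mathlib`, crux item hLiu418 = `stmt-HodgeConjecture-24832`; squad K2 ∕ K2Liu; prover K2Liu-p01 (g2), steward of #41.
THEOREMS ONLY (no `def`, no instance, no notation, no named-fact hypothesis, no `sorry`); lane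
`--supports stmt-HodgeConjecture-24832` (count-neutral helper).

THE OBJECT.  In the Gindikin–Karpelevich computation of the unramified Siegel intertwining operator `M_v(s)φ°` of
`U(2,2)` (organ O41.5 of #41: `w_Δ` has length `3` in `W(C₂)`, `M(w_Δ) = M(s_{2e₁})M(s_{e₁+e₂})M(s_{2e₂})`), every
rank-one factor is — after the Iwasawa decomposition of `w·n(x)` in `SL₂`, `U(1,1)` or `Res SL₂(E_w)` — the integral over
the root group `K = F_v` (or `E_w`) of the function which is `1` on `𝒪_K` and `t^m` on the sphere `‖x‖_K = q^m` (`m ≥ 1`),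
`t = λ(a_α) q^{-1}` the unramified datum.  THIS FILE evaluates that integral once and for all, for ANY non-archimedean
local field `K` (Mathlib `IsNonarchimedeanLocalField`) and ANY additive Haar measure `μ`:

* §1 the OUTWARD shell decomposition `K ∖ 𝒪 = ⨆_{m ≥ 1} (𝔭^{-m} ∖ 𝔭^{-m+1})`, spheres of measure `q^m (1 − q⁻¹) μ(𝒪)`
  (★ `LocalFieldHaar.measureReal_shell`);
* §2 **`integrable_and_integral_eq_of_shells`** — the ENGINE: if `g = 1` on `𝒪` and `g = t^m` on the sphere `‖x‖ = q^m`
  (`m ≥ 1`) with `‖t‖ < q⁻¹`, then `g ∈ L¹(μ)` and **`∫_K g dμ = μ(𝒪) · (1 − t)/(1 − q t)`**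
  (`= μ(𝒪)·[1 + (1 − q⁻¹) Σ_{m≥1} (qt)^m]`, a geometric series);
* §3 **`integrable_and_integral_max_one_normAbs_cpow`** — the `SL₂`-shape: for `1 < Re z`,
  **`∫_K (max 1 ‖x‖_K)^{−z} dμ(x) = μ(𝒪) · (1 − q^{−z})/(1 − q^{1−z}) = μ(𝒪) · ζ_K(z − 1)/ζ_K(z)`**,
  i.e. `c_α(λ) = L(0, λ∘α^∨)/L(1, λ∘α^∨)` with `λ(a_α) = q^{1−z}` — Langlands' rank-one factor
  [Casselman1980, §3 Thm. 3.1; GelbartPiatetskishapiroRallis1987, Part A §5; Tan1999, §2].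

HOW O41.5 USES IT (REPORT-FIRST O41.5 §2, inert `v`, `X = χ_w(ϖ) q^{−2s}`): the three factors are this integral with
`(K, t) = (F_v, X)`, `(F_v, q⁻²X)`, `(E_w, q_E⁻¹X²)`, giving `(1−X)/(1−qX) · (1−q⁻²X)/(1−q⁻¹X) · (1−q⁻²X²)/(1−X²)
= L(2s−1,χ⁰)L(2s,χ⁰ε)/(L(2s+2,χ⁰)L(2s+1,χ⁰ε)) = a_v(s)/b_v(s)` — ★ O41.6 `hasProd_localScalar`'s local scalar under parity.
HONEST LABEL.  Count-neutral helper; it retires nothing by itself: `HC_CM` is proved only modulo the 7 printed citations (2 remaining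
named inputs: hLiu418 = `stmt-HodgeConjecture-24832`, h413 = `stmt-HodgeConjecture-24833`) until rung 0 closes.

## References
* [Casselman1980] W. Casselman, *The unramified principal series of p-adic groups I. The spherical function*, Compositio Math. 40
  (1980) 387–406: §3 (the rank-one intertwining integral, `c_α`), Thm. 3.1.
* [GelbartPiatetskishapiroRallis1987] S. Gelbart, I. Piatetski-Shapiro, S. Rallis, LNM 1254 (1987), Part A §5 (unramified computation).
* [Tan1999] V. Tan, *Poles of Siegel Eisenstein series on U(n,n)*, Canad. J. Math. 51 (1999): §2.
* [Tate1950] J. Tate, *Fourier analysis in number fields…* (1950), §2.2 Lemma 2.2.5, §2.4–2.5 (shell sums).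
-/

set_option autoImplicit false
set_option linter.dupNamespace false -- the mandated namespace repeats `HodgeConjecture.HodgeConjecture`

noncomputable section

open MeasureTheory Filter Topology Set
open scoped NNReal ENNReal
open Literature.NumberTheory.GaloisRepresentations.IsNonarchimedeanLocalField
open Literature.NumberTheory.Automorphic Literature.NumberTheory.Automorphic.LocalFieldHaar

namespace Summit.HodgeConjecture.HodgeConjecture.Cruxes.HLiu418.K2LiuGKRankOneIntegral

variable {F : Type*} [Field F] [ValuativeRel F] [TopologicalSpace F] [IsNonarchimedeanLocalField F]

/-! ## §1 The outward shell decomposition of `K ∖ 𝒪` -/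

/-- `1 < q` as a real number. [folklore] -/
theorem one_lt_residueFieldCard_real : (1 : ℝ) < (residueFieldCard F : ℝ) := by
  exact_mod_cast one_lt_residueFieldCard F

/-- On the sphere `𝔭^{-(m+1)} ∖ 𝔭^{-m}` the normalised absolute value is `q^{m+1}` (as a real number).
[cite: Tate1950, §2.5] -/
theorem coe_normAbs_of_mem_outerShell {m : ℕ} {x : F}
    (hx : x ∈ primePowBall F (-((m : ℤ) + 1)) \ primePowBall F (-((m : ℤ) + 1) + 1)) :
    ((normAbs F x : ℝ≥0) : ℝ) = (residueFieldCard F : ℝ) ^ (m + 1) := by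
  rw [mem_shell_iff] at hx
  rw [hx, NNReal.coe_zpow, NNReal.coe_inv, NNReal.coe_natCast, inv_zpow', neg_neg, ← Nat.cast_succ, zpow_natCast]

/-- Points of the outer spheres are NOT in `𝒪` (`q^{m+1} > 1`). [cite: Tate1950, §2.5] -/
theorem not_mem_primePowBall_zero_of_mem_outerShell {m : ℕ} {x : F}
    (hx : x ∈ primePowBall F (-((m : ℤ) + 1)) \ primePowBall F (-((m : ℤ) + 1) + 1)) :
    x ∉ primePowBall F 0 := by
  intro h0
  rw [mem_primePowBall_iff, zpow_zero] at h0
  have h1 : ((normAbs F x : ℝ≥0) : ℝ) ≤ 1 := by exact_mod_cast h0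
  rw [coe_normAbs_of_mem_outerShell hx] at h1
  exact not_lt.2 h1 (one_lt_pow₀ one_lt_residueFieldCard_real (Nat.succ_ne_zero m))

/-- **`K ∖ 𝒪 = ⋃_{m ≥ 0} (𝔭^{-(m+1)} ∖ 𝔭^{-m})`**: the complement of the valuation ring is the union of the outer spheres
`‖x‖ = q^{m+1}`. [cite: Tate1950, §2.5] -/
theorem compl_primePowBall_zero_eq_iUnion :
    (primePowBall F 0)ᶜ = ⋃ m : ℕ, primePowBall F (-((m : ℤ) + 1)) \ primePowBall F (-((m : ℤ) + 1) + 1) := by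
  ext x
  simp only [Set.mem_compl_iff, Set.mem_iUnion]
  constructor
  · intro hx
    have hx0 : x ≠ 0 := by
      rintro rfl
      exact hx (zero_mem_primePowBall 0)
    obtain ⟨k, hk⟩ := exists_normAbs_eq_inv_zpow hx0
    have hk0 : k < 0 := by
      by_contra hk0
      apply hx
      rw [mem_primePowBall_iff, hk]
      exact zpow_le_zpow_right_of_le_one₀ inv_residueFieldCard_pos inv_residueFieldCard_lt_one.le (not_lt.1 hk0)
    refine ⟨(-k - 1).toNat, ?_⟩
    rw [mem_shell_iff, hk]
    congr 1
    omega
  · rintro ⟨m, hm⟩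
    exact not_mem_primePowBall_zero_of_mem_outerShell hm

/-- The outer spheres are pairwise disjoint. [cite: Tate1950, §2.5] -/
theorem pairwise_disjoint_outerShell :
    Pairwise (Function.onFun Disjoint fun m : ℕ =>
      primePowBall F (-((m : ℤ) + 1)) \ primePowBall F (-((m : ℤ) + 1) + 1)) := fun m m' h =>
  disjoint_shell (by omega)

section Measure

variable [MeasurableSpace F] [BorelSpace F] (μ : Measure F) [μ.IsAddHaarMeasure]

/-- **Measure of the outer sphere** `μ(𝔭^{-(m+1)} ∖ 𝔭^{-m}) = q^{m+1} (1 − q⁻¹) μ(𝒪)`. [cite: Tate1950, §2.2 Lemma 2.2.5, §2.5] -/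
theorem measureReal_outerShell (m : ℕ) :
    μ.real (primePowBall F (-((m : ℤ) + 1)) \ primePowBall F (-((m : ℤ) + 1) + 1)) =
      (residueFieldCard F : ℝ) ^ (m + 1) * (1 - (residueFieldCard F : ℝ)⁻¹) * μ.real (primePowBall F 0) := by
  rw [measureReal_shell μ, inv_zpow', neg_neg, ← Nat.cast_succ, zpow_natCast]

/-! ## §2 The engine: integrating a function that is `1` on `𝒪` and `t^m` on the sphere `‖x‖ = q^m` -/

/-- **THE RANK-ONE SHELL SUM.**  Let `g : K → ℂ` be ANY function with `g = 1` on `𝒪` and `g = t^{m+1}` on the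
sphere `𝔭^{-(m+1)} ∖ 𝔭^{-m}` (`m ≥ 0`), where `‖t‖ < q⁻¹` (the pieces cover `K`, so `g` is determined, piecewise constant, measurable).  Then `g ∈ L¹(μ)` and
`∫_K g dμ = μ(𝒪) · (1 − t)/(1 − q t)`.  (Shell by shell: `μ(𝒪)·[1 + (1 − q⁻¹) Σ_{m≥1} (q t)^m]`.)
[cite: Casselman1980, §3 Thm. 3.1] [cite: Tate1950, §2.4–2.5] -/
theorem integrable_and_integral_eq_of_shells (g : F → ℂ) {t : ℂ}
    (ht : ‖t‖ < (residueFieldCard F : ℝ)⁻¹) (h0 : ∀ x ∈ primePowBall F 0, g x = 1)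
    (hS : ∀ (m : ℕ) (x : F), x ∈ primePowBall F (-((m : ℤ) + 1)) \ primePowBall F (-((m : ℤ) + 1) + 1) → g x = t ^ (m + 1)) :
    Integrable g μ ∧ ∫ x, g x ∂μ = μ.real (primePowBall F 0) * ((1 - t) / (1 - (residueFieldCard F : ℂ) * t)) := by
  set S : ℕ → Set F := fun m => primePowBall F (-((m : ℤ) + 1)) \ primePowBall F (-((m : ℤ) + 1) + 1) with hS_def
  have hq1 : (1 : ℝ) < residueFieldCard F := one_lt_residueFieldCard_real
  have hq0 : (0 : ℝ) < residueFieldCard F := one_pos.trans hq1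
  have hqt' : (residueFieldCard F : ℝ) * ‖t‖ < 1 := by
    calc (residueFieldCard F : ℝ) * ‖t‖ < residueFieldCard F * (residueFieldCard F : ℝ)⁻¹ := mul_lt_mul_of_pos_left ht hq0
      _ = 1 := mul_inv_cancel₀ hq0.ne'
  have hqt : ‖(residueFieldCard F : ℂ) * t‖ < 1 := by
    rwa [norm_mul, Complex.norm_natCast]
  have hqt0 : 0 ≤ (residueFieldCard F : ℝ) * ‖t‖ := mul_nonneg hq0.le (norm_nonneg _)
  have hSm : ∀ m, MeasurableSet (S m) := fun m => measurableSet_shell _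
  have hSfin : ∀ m, μ (S m) ≠ ∞ := fun m =>
    ((measure_mono fun x hx => hx.1).trans_lt (measure_primePowBall_lt_top μ _)).ne
  -- the piece `𝒪`
  have hO_int : IntegrableOn g (primePowBall F 0) μ :=
    IntegrableOn.congr_fun (integrableOn_const (measure_primePowBall_lt_top μ 0).ne) (fun x hx => (h0 x hx).symm)
      (measurableSet_primePowBall 0)
  have hO_val : ∫ x in primePowBall F 0, g x ∂μ = μ.real (primePowBall F 0) := by
    rw [setIntegral_congr_fun (measurableSet_primePowBall 0) (fun x hx => h0 x hx), setIntegral_const, Complex.real_smul,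
      mul_one]
  -- the outer spheres
  have hS_int : ∀ m, IntegrableOn g (S m) μ := fun m =>
    IntegrableOn.congr_fun (integrableOn_const (hSfin m)) (fun x hx => (hS m x hx).symm) (hSm m)
  have hS_val : ∀ m, ∫ x in S m, g x ∂μ =
      (μ.real (primePowBall F 0) * (1 - (residueFieldCard F : ℂ)⁻¹)) * ((residueFieldCard F : ℂ) * t) ^ (m + 1) := by
    intro m
    rw [setIntegral_congr_fun (hSm m) (fun x hx => hS m x hx), setIntegral_const, hS_def, measureReal_outerShell μ m,
      Complex.real_smul, mul_pow]
    push_cast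
    ring
  have hS_norm : ∀ m, ∫ x in S m, ‖g x‖ ∂μ =
      μ.real (primePowBall F 0) * (1 - (residueFieldCard F : ℝ)⁻¹) * ((residueFieldCard F : ℝ) * ‖t‖) ^ (m + 1) := by
    intro m
    rw [setIntegral_congr_fun (hSm m) (fun x hx => by rw [hS m x hx]), setIntegral_const, hS_def,
      measureReal_outerShell μ m, smul_eq_mul, norm_pow, mul_pow]
    ring
  -- summability over the spheres (geometric, ratio `q‖t‖ < 1`)
  have hsum_norm : Summable fun m : ℕ => ∫ x in S m, ‖g x‖ ∂μ := by
    simp_rw [hS_norm]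
    refine Summable.mul_left _ ?_
    simp_rw [pow_succ]
    exact (summable_geometric_of_lt_one hqt0 hqt').mul_right _
  have hSc_int : IntegrableOn g (primePowBall F 0)ᶜ μ := by
    rw [compl_primePowBall_zero_eq_iUnion]
    exact integrableOn_iUnion_of_summable_integral_norm hS_int hsum_norm
  have hint : Integrable g μ := by
    rw [← integrableOn_univ, ← Set.union_compl_self (primePowBall F 0)]
    exact hO_int.union hSc_int
  refine ⟨hint, ?_⟩
  -- the value: `∫ = ∫_𝒪 + Σ_m ∫_{S m}`
  have hSc_sum : HasSum (fun m => ∫ x in S m, g x ∂μ) (∫ x in (primePowBall F 0)ᶜ, g x ∂μ) := by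
    have h := hasSum_integral_iUnion (μ := μ) (f := g) hSm pairwise_disjoint_outerShell
      (by rw [← compl_primePowBall_zero_eq_iUnion]; exact hSc_int)
    rwa [← compl_primePowBall_zero_eq_iUnion] at h
  have hgeom : HasSum (fun m : ℕ => (μ.real (primePowBall F 0) * (1 - (residueFieldCard F : ℂ)⁻¹)) *
        ((residueFieldCard F : ℂ) * t) ^ (m + 1))
      ((μ.real (primePowBall F 0) * (1 - (residueFieldCard F : ℂ)⁻¹)) *
        ((residueFieldCard F : ℂ) * t * (1 - (residueFieldCard F : ℂ) * t)⁻¹)) := by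
    refine HasSum.mul_left _ ?_
    simp_rw [pow_succ']
    exact (hasSum_geometric_of_norm_lt_one hqt).mul_left _
  have hSc_val : ∫ x in (primePowBall F 0)ᶜ, g x ∂μ = (μ.real (primePowBall F 0) * (1 - (residueFieldCard F : ℂ)⁻¹)) *
      ((residueFieldCard F : ℂ) * t * (1 - (residueFieldCard F : ℂ) * t)⁻¹) := by
    refine hSc_sum.unique ?_
    simp_rw [hS_val]
    exact hgeom
  rw [← integral_add_compl (measurableSet_primePowBall 0) hint, hO_val, hSc_val]
  have h1 : (1 : ℂ) - (residueFieldCard F : ℂ) * t ≠ 0 := by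
    intro h
    have : ‖(residueFieldCard F : ℂ) * t‖ = 1 := by rw [← sub_eq_zero.1 h, norm_one]
    exact hqt.ne this
  have hq0' : (residueFieldCard F : ℂ) ≠ 0 := by exact_mod_cast hq0.ne'
  field_simp
  ring

/-! ## §3 The `SL₂`-shape: `∫_K (max 1 ‖x‖)^{−z} dμ = μ(𝒪) ζ_K(z−1)/ζ_K(z)` -/

omit [MeasurableSpace F] [BorelSpace F] in
/-- `x ↦ (max 1 ‖x‖_K : ℂ)^{−z}` is continuous (the base is a real number `≥ 1`, inside the slit plane). [folklore] -/
theorem continuous_max_one_normAbs_cpow (z : ℂ) :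
    Continuous fun x : F => (((max 1 ((normAbs F x : ℝ≥0) : ℝ) : ℝ) : ℂ) ^ (-z)) := by
  have hc : Continuous fun x : F => (((max 1 ((normAbs F x : ℝ≥0) : ℝ) : ℝ) : ℂ)) :=
    Complex.continuous_ofReal.comp (continuous_const.max (NNReal.continuous_coe.comp continuous_normAbs))
  exact hc.cpow continuous_const fun x => Complex.ofReal_mem_slitPlane.2 (lt_of_lt_of_le one_pos (le_max_left _ _))

omit [MeasurableSpace F] [BorelSpace F] in
/-- `(q^n)^w = (q^w)^n` for the positive real base `q` (real logarithm, no branch issue). [folklore] -/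
theorem ofReal_pow_cpow (n : ℕ) (w : ℂ) :
    (((residueFieldCard F : ℝ) ^ n : ℝ) : ℂ) ^ w = ((residueFieldCard F : ℂ) ^ w) ^ n := by
  have hq0 : (0 : ℝ) < residueFieldCard F := one_pos.trans one_lt_residueFieldCard_real
  have hqn : (((residueFieldCard F : ℝ) ^ n : ℝ) : ℂ) ≠ 0 := by exact_mod_cast (pow_pos hq0 n).ne'
  have hq0' : ((residueFieldCard F : ℝ) : ℂ) ≠ 0 := by exact_mod_cast hq0.ne'
  rw [show (residueFieldCard F : ℂ) = ((residueFieldCard F : ℝ) : ℂ) by push_cast; rfl,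
    Complex.cpow_def_of_ne_zero hqn, Complex.cpow_def_of_ne_zero hq0', ← Complex.exp_nat_mul,
    ← Complex.ofReal_log (pow_pos hq0 n).le, Real.log_pow, ← Complex.ofReal_log hq0.le]
  push_cast
  ring_nf

/-- **THE RANK-ONE UNRAMIFIED INTERTWINING INTEGRAL** (`SL₂`-shape, trivial character): for `1 < Re z` and any additive Haar
measure `μ` on the non-archimedean local field `K`,
`∫_K (max 1 ‖x‖_K)^{−z} dμ(x) = μ(𝒪_K) · (1 − q^{−z})/(1 − q^{1−z})` (`= μ(𝒪) ζ_K(z−1)/ζ_K(z)`, `ζ_K(w) = (1 − q^{−w})⁻¹`), and the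
integrand is integrable.  With `φ°(w n(x)) = (max 1 ‖x‖)^{−(⟨λ,α^∨⟩+1)}` this is `c_α(λ) = (1 − q⁻¹λ(a_α))/(1 − λ(a_α))`.
[cite: Casselman1980, §3 Thm. 3.1] [cite: GelbartPiatetskishapiroRallis1987, Part A §5] [cite: Tan1999, §2] -/
theorem integrable_and_integral_max_one_normAbs_cpow {z : ℂ} (hz : 1 < z.re) :
    Integrable (fun x : F => (((max 1 ((normAbs F x : ℝ≥0) : ℝ) : ℝ) : ℂ) ^ (-z))) μ ∧
    ∫ x, (((max 1 ((normAbs F x : ℝ≥0) : ℝ) : ℝ) : ℂ) ^ (-z)) ∂μ =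
      μ.real (primePowBall F 0) *
        ((1 - (residueFieldCard F : ℂ) ^ (-z)) / (1 - (residueFieldCard F : ℂ) ^ (1 - z))) := by
  have hq1 : (1 : ℝ) < residueFieldCard F := one_lt_residueFieldCard_real
  have hq0 : (0 : ℝ) < residueFieldCard F := one_pos.trans hq1
  have hq0' : (residueFieldCard F : ℂ) ≠ 0 := by exact_mod_cast hq0.ne'
  -- the datum `t = q^{-z}`, `‖t‖ = q^{-Re z} < q⁻¹`
  have ht : ‖(residueFieldCard F : ℂ) ^ (-z)‖ < (residueFieldCard F : ℝ)⁻¹ := by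
    rw [show (residueFieldCard F : ℂ) = ((residueFieldCard F : ℝ) : ℂ) by push_cast; rfl,
      Complex.norm_cpow_eq_rpow_re_of_pos hq0, Complex.neg_re, ← Real.rpow_neg_one]
    exact Real.rpow_lt_rpow_of_exponent_lt hq1 (by linarith)
  have h := integrable_and_integral_eq_of_shells μ (fun x : F => (((max 1 ((normAbs F x : ℝ≥0) : ℝ) : ℝ) : ℂ) ^ (-z))) ht
    (fun x hx => by
      rw [mem_primePowBall_iff, zpow_zero] at hx
      have hx' : ((normAbs F x : ℝ≥0) : ℝ) ≤ 1 := by exact_mod_cast hx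
      show (((max 1 ((normAbs F x : ℝ≥0) : ℝ) : ℝ) : ℂ) ^ (-z)) = 1
      rw [max_eq_left hx', Complex.ofReal_one, Complex.one_cpow])
    (fun m x hx => by
      show (((max 1 ((normAbs F x : ℝ≥0) : ℝ) : ℝ) : ℂ) ^ (-z)) = _
      rw [coe_normAbs_of_mem_outerShell hx, max_eq_right (one_le_pow₀ hq1.le), ofReal_pow_cpow])
  refine ⟨h.1, ?_⟩
  rw [h.2, sub_eq_add_neg (1 : ℂ) z, Complex.cpow_add _ _ hq0', Complex.cpow_one]

end Measure

end Summit.HodgeConjecture.HodgeConjecture.Cruxes.HLiu418.K2LiuGKRankOneIntegral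

end
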